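import Mathlib
import Summits.NavierStokesRegularity.NavierStokesRegularity.Theorems.EulerZoomLiouvillePowerGaugeEulerLiouvilleClockTransferGauges
import HarnessLib

/-!
# CENTRE TRANSFER of a past power clock, part 2: the OWN-RATE WEIGHTS of the profile are finite
# (crux `EulerZoomLiouville.PowerGaugeEulerLiouville` = stmt-NavierStokesRegularity-19832; line `logtime-breathers`, residue T4 «window clocks»)

Route `EulerZoomLiouville` (NavierStokesRegularity); width seat ns-ezl-w6 g2 (cell ns-regularity-ideate, LEAD ns-typeII-p2).  Let `γ = 1/(2+ρ)` and let
`v(τ) = selfSimilarCollapse γ 0 W τ`, `K(τ) = (−τ)^{−1} • G((−τ)^{−γ} ·)`, `q(τ) = selfSimilarCollapsePressure γ 0 Q τ` (`τ < 0`) be exactly self-similar about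
the ORIGIN (e.g. the translate of a `T₁ = T` power clock, `…ClockTransferTranslate`).  The reverse gauge dictionary (`…ClockTransferGauges`) turns the OWN-RATE
data `sup_L L^{2ρ−1}∫_{B_L}‖W‖²`, `∫|G|²_F‖z‖^{ρ−1}`, `∫|Q|^{3/2}‖z‖^{2ρ−2}` into the three gauges of class `ρ`; here these data are proved FINITE from the
finiteness of the sliced energy / dissipation / pressure of `(v, K, q)` on the UNIT cylinder `Q_1(0,0)` (large profile scales) and local regularity of the
profile near the origin of profile space (small scales): `ClockTransfer.lintegral_Ioo_rpow_mul_ball_ge` (REVERSE Tonelli bound on `Q_1`: over a profile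
point with `‖z‖ ≥ 1` the whole time section `(−‖z‖^{−1/γ}, 0) ⊆ (−1,0)` sees `z`), `exists_normEnergy_bound` (`W` continuous; `−1 ≤ ρ`),
`gradientWeight_ne_top` (`G` continuous; `ρ < 1`; near `0` by Mathlib's `integrableOn_ball_of_norm_le_rpow`, exponent `1−ρ < 3`), `pressureWeight_ne_top`
(`Q` essentially bounded on `B_1`; `−1/2 < ρ < 1`).
WHAT THIS IS NOT: not NS, not E — measure-theoretic lemmas on the MODEL lattice (strata of the crux CLASS 19832), `--supports` stmt-19832; 19832 OPEN;
NS regularity NOT proved. [folklore]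
-/

noncomputable section

-- flat `Theorems/<Route><Decl>…` files of one crux share the namespace of the crux (tree convention: `Summit.<S>.<S>.…`)
set_option linter.dupNamespace false

open MeasureTheory Set Filter Topology Metric Function TopologicalSpace
open scoped ENNReal NNReal

namespace Summit.NavierStokesRegularity.NavierStokesRegularity.Theorems.PowerGaugeEulerLiouville

open Literature.Analysis Literature.Analysis.FunctionSpaces Literature.Analysis.FluidPDE

namespace ClockTransfer

/-! ### The reverse Tonelli bound on the unit cylinder -/

/-- **Reverse Tonelli bound on the unit cylinder.**  For `γ > 0`, `e > −1` and a.e.-measurable `f ≥ 0` on `ℝ³`: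
`(1/(e+1)) ∫_{‖z‖ ≥ 1} f(z) ‖z‖^{−(e+1)/γ} dz ≤ ∫_{τ ∈ (−1,0)} (−τ)^e ∫_{B(0,(−τ)^{−γ})} f dτ`: over a profile point with `‖z‖ ≥ 1` the whole time
section `(−‖z‖^{−1/γ}, 0) ⊆ (−1, 0)` sees `z`, and `∫_{(−b,0)}(−τ)^e = b^{e+1}/(e+1)` (`lintegral_Ioo_neg_rpow`). [folklore] -/
theorem lintegral_Ioo_rpow_mul_ball_ge {γ e : ℝ} (hγ : 0 < γ) (he : -1 < e)
    {f : EuclideanSpace ℝ (Fin 3) → ℝ≥0∞} (hf : AEMeasurable f volume) :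
    ENNReal.ofReal (1 / (e + 1)) *
        ∫⁻ z in {z : EuclideanSpace ℝ (Fin 3) | 1 ≤ ‖z‖}, f z * ENNReal.ofReal (‖z‖ ^ (-((e + 1) / γ))) ≤
      ∫⁻ τ in Ioo (-((1 : ℝ) ^ 2)) 0, ENNReal.ofReal ((-τ) ^ e) *
        ∫⁻ z in ball (0 : EuclideanSpace ℝ (Fin 3)) ((-τ) ^ (-γ) * 1), f z := by
  have he1 : 0 < e + 1 := by linarith
  rw [one_pow]
  -- the joint integrand
  set S : Set (ℝ × EuclideanSpace ℝ (Fin 3)) := {q | ‖q.2‖ < (-q.1) ^ (-γ) * 1} with hS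
  have hSm : MeasurableSet S := by
    rw [hS]
    exact measurableSet_lt measurable_snd.norm ((measurable_fst.neg.pow_const _).mul_const 1)
  set F : ℝ × EuclideanSpace ℝ (Fin 3) → ℝ≥0∞ :=
    fun q => S.indicator (fun q => ENNReal.ofReal ((-q.1) ^ e) * f q.2) q with hF
  have hFm : AEMeasurable F (((volume : Measure ℝ).restrict (Ioo (-1) 0)).prod
      (volume : Measure (EuclideanSpace ℝ (Fin 3)))) := by
    refine AEMeasurable.indicator ?_ hSm
    exact (measurable_fst.neg.pow_const _).ennreal_ofReal.aemeasurable.mul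
      (hf.comp_quasiMeasurePreserving Measure.quasiMeasurePreserving_snd)
  -- (1) the right-hand side as an iterated integral of `F`, then swapped
  have hL : ∫⁻ τ in Ioo (-(1 : ℝ)) 0, ENNReal.ofReal ((-τ) ^ e) *
        ∫⁻ z in ball (0 : EuclideanSpace ℝ (Fin 3)) ((-τ) ^ (-γ) * 1), f z =
      ∫⁻ τ in Ioo (-(1 : ℝ)) 0, ∫⁻ z, F (τ, z) := by
    refine lintegral_congr fun τ => ?_
    rw [← lintegral_indicator measurableSet_ball,
      ← lintegral_const_mul'' _ (hf.indicator measurableSet_ball)]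
    refine lintegral_congr fun z => ?_
    rw [hF]
    simp only [hS, indicator, mem_setOf_eq, mem_ball_zero_iff]
    split_ifs <;> simp
  have hswap : ∫⁻ τ in Ioo (-(1 : ℝ)) 0, ∫⁻ z, F (τ, z) = ∫⁻ z, ∫⁻ τ in Ioo (-(1 : ℝ)) 0, F (τ, z) :=
    lintegral_lintegral_swap hFm
  -- (2) the inner integral from below, `‖z‖ ≥ 1`
  have hinner : ∀ z : EuclideanSpace ℝ (Fin 3), 1 ≤ ‖z‖ →
      ENNReal.ofReal (1 / (e + 1)) * (f z * ENNReal.ofReal (‖z‖ ^ (-((e + 1) / γ)))) ≤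
        ∫⁻ τ in Ioo (-(1 : ℝ)) 0, F (τ, z) := by
    intro z hz
    have hz' : 0 < ‖z‖ := by linarith
    set b : ℝ := ‖z‖ ^ (-(1 / γ)) with hb
    have hb0 : 0 < b := Real.rpow_pos_of_pos hz' _
    have hb1 : b ≤ 1 := by
      rw [hb]; exact Real.rpow_le_one_of_one_le_of_nonpos hz (by rw [neg_nonpos]; positivity)
    -- on `(−b, 0)` the section sees `z`
    have hpt : ∀ τ ∈ Ioo (-b) 0, F (τ, z) = ENNReal.ofReal ((-τ) ^ e) * f z := by
      intro τ hτ
      have hτ0 : 0 < -τ := neg_pos.2 hτ.2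
      have hτb : -τ < b := by linarith [hτ.1]
      have hsee : ‖z‖ < (-τ) ^ (-γ) * 1 := by
        rw [mul_one]
        -- `‖z‖ = b^{−γ} < (−τ)^{−γ}`
        have h1 : ‖z‖ = b ^ (-γ) := by
          rw [hb, ← Real.rpow_mul hz'.le]
          rw [show -(1 / γ) * -γ = 1 by field_simp, Real.rpow_one]
        rw [h1]
        exact Real.rpow_lt_rpow_of_neg hτ0 hτb (by linarith)
      rw [hF]
      simp only [hS, indicator, mem_setOf_eq]
      rw [if_pos hsee]
    have hbpow : b ^ (e + 1) = ‖z‖ ^ (-((e + 1) / γ)) := by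
      rw [hb, ← Real.rpow_mul hz'.le]
      congr 1
      field_simp
    calc ENNReal.ofReal (1 / (e + 1)) * (f z * ENNReal.ofReal (‖z‖ ^ (-((e + 1) / γ))))
        = ENNReal.ofReal (b ^ (e + 1) / (e + 1)) * f z := by
          rw [hbpow, mul_comm (f z), ← mul_assoc, ← ENNReal.ofReal_mul (by positivity)]
          congr 2
          ring
      _ = (∫⁻ τ in Ioo (-b) 0, ENNReal.ofReal ((-τ) ^ e)) * f z := by rw [lintegral_Ioo_neg_rpow he hb0]
      _ = ∫⁻ τ in Ioo (-b) 0, ENNReal.ofReal ((-τ) ^ e) * f z := by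
          have hm : Measurable fun τ : ℝ => ENNReal.ofReal ((-τ) ^ e) :=
            (measurable_id'.neg.pow_const e).ennreal_ofReal
          rw [lintegral_mul_const _ hm]
      _ = ∫⁻ τ in Ioo (-b) 0, F (τ, z) := (setLIntegral_congr_fun measurableSet_Ioo hpt).symm
      _ ≤ ∫⁻ τ in Ioo (-(1 : ℝ)) 0, F (τ, z) :=
          lintegral_mono_set (Ioo_subset_Ioo (by linarith) le_rfl)
  -- (3) assemble
  rw [hL, hswap]
  calc ENNReal.ofReal (1 / (e + 1)) *
        ∫⁻ z in {z : EuclideanSpace ℝ (Fin 3) | 1 ≤ ‖z‖}, f z * ENNReal.ofReal (‖z‖ ^ (-((e + 1) / γ)))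
      = ∫⁻ z in {z : EuclideanSpace ℝ (Fin 3) | 1 ≤ ‖z‖},
          ENNReal.ofReal (1 / (e + 1)) * (f z * ENNReal.ofReal (‖z‖ ^ (-((e + 1) / γ)))) :=
        (lintegral_const_mul'' _
          (by exact (hf.mul (measurable_norm.pow_const _).ennreal_ofReal.aemeasurable).restrict)).symm
    _ ≤ ∫⁻ z in {z : EuclideanSpace ℝ (Fin 3) | 1 ≤ ‖z‖}, ∫⁻ τ in Ioo (-(1 : ℝ)) 0, F (τ, z) :=
        setLIntegral_mono' (measurableSet_le measurable_const measurable_norm) fun z hz => hinner z hz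
    _ ≤ ∫⁻ z, ∫⁻ τ in Ioo (-(1 : ℝ)) 0, F (τ, z) := setLIntegral_le_lintegral _ _

/-! ### The normalised energy of the profile at all scales -/

/-- **`∫_{B_L}‖W‖² ≤ N L^{1−2ρ}` FOR ALL `L > 0`** (`γ = 1/(2+ρ)`, `−1 ≤ ρ`, `ρ > −2`): large scales `L > 1` from the sliced energies
`∫_{B_1}‖v(t)‖² ≤ K` of `v = selfSimilarCollapse γ 0 W` at the times `t = −L^{−(2+ρ)} ∈ (−1, 0)` (exact scaling, `L^{2ρ−1}∫_{B_L}‖W‖² = ∫_{B_1}‖v(t)‖²`),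
small scales `L ≤ 1` from the continuity of `W` (`∫_{B_L}‖W‖² ≤ sup_{B_1}‖W‖² · vol B_L` and `L³ ≤ L^{1−2ρ}`). [folklore] -/
theorem exists_normEnergy_bound {ρ : ℝ} (hρ : 0 < 2 + ρ) (hρ1 : -1 ≤ ρ)
    {v : ℝ → EuclideanSpace ℝ (Fin 3) → EuclideanSpace ℝ (Fin 3)}
    {W : EuclideanSpace ℝ (Fin 3) → EuclideanSpace ℝ (Fin 3)} (hW : Continuous W)
    (hv : ∀ τ : ℝ, τ < 0 → v τ = selfSimilarCollapse (1 / (2 + ρ)) 0 W τ)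
    {K : ℝ≥0∞} (hK : K ≠ ⊤)
    (hslice : ∀ t ∈ Ioo (-1 : ℝ) 0, ∫⁻ x in ball (0 : EuclideanSpace ℝ (Fin 3)) 1, ‖v t x‖ₑ ^ 2 ≤ K) :
    ∃ N : ℝ≥0, ∀ L : ℝ, 0 < L →
      ∫⁻ y in ball (0 : EuclideanSpace ℝ (Fin 3)) L, ‖W y‖ₑ ^ 2 ≤ (N : ℝ≥0∞) * ENNReal.ofReal (L ^ (1 - 2 * ρ)) := by
  set γ : ℝ := 1 / (2 + ρ) with hγ
  have hγρ : γ * (2 + ρ) = 1 := by rw [hγ]; field_simp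
  have hγ0 : 0 < γ := by rw [hγ]; positivity
  -- the sup bound near the origin of profile space
  obtain ⟨B, hB⟩ : ∃ B, ∀ y ∈ closedBall (0 : EuclideanSpace ℝ (Fin 3)) 1, ‖W y‖ ≤ B :=
    (isCompact_closedBall 0 1).exists_bound_of_continuousOn hW.continuousOn
  set C : ℝ≥0∞ := ENNReal.ofReal (B ^ 2) * volume (ball (0 : EuclideanSpace ℝ (Fin 3)) 1) with hCdef
  have hC : C ≠ ⊤ := ENNReal.mul_ne_top ENNReal.ofReal_ne_top measure_ball_lt_top.ne
  have hKC : K + C ≠ ⊤ := ENNReal.add_ne_top.2 ⟨hK, hC⟩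
  refine ⟨(K + C).toNNReal, fun L hL => ?_⟩
  rw [ENNReal.coe_toNNReal hKC]
  by_cases hL1 : L ≤ 1
  · -- small scales
    have hvol : volume (ball (0 : EuclideanSpace ℝ (Fin 3)) L) =
        ENNReal.ofReal (L ^ 3) * volume (ball (0 : EuclideanSpace ℝ (Fin 3)) 1) := by
      rw [Measure.addHaar_ball_of_pos volume 0 hL, finrank_euclideanSpace_fin]
    have hbound : ∫⁻ y in ball (0 : EuclideanSpace ℝ (Fin 3)) L, ‖W y‖ₑ ^ 2 ≤
        ENNReal.ofReal (B ^ 2) * volume (ball (0 : EuclideanSpace ℝ (Fin 3)) L) := by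
      calc ∫⁻ y in ball (0 : EuclideanSpace ℝ (Fin 3)) L, ‖W y‖ₑ ^ 2
          ≤ ∫⁻ y in ball (0 : EuclideanSpace ℝ (Fin 3)) L, ENNReal.ofReal (B ^ 2) := by
            refine setLIntegral_mono' measurableSet_ball fun y hy => ?_
            have hy1 : y ∈ closedBall (0 : EuclideanSpace ℝ (Fin 3)) 1 :=
              closedBall_subset_closedBall hL1 (ball_subset_closedBall hy)
            rw [← ofReal_norm, ← ENNReal.ofReal_pow (norm_nonneg _)]
            exact ENNReal.ofReal_le_ofReal (pow_le_pow_left₀ (norm_nonneg _) (hB y hy1) 2)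
        _ = ENNReal.ofReal (B ^ 2) * volume (ball (0 : EuclideanSpace ℝ (Fin 3)) L) := setLIntegral_const _ _
    have hL3 : ENNReal.ofReal (L ^ 3) ≤ ENNReal.ofReal (L ^ (1 - 2 * ρ)) := by
      refine ENNReal.ofReal_le_ofReal ?_
      rw [← Real.rpow_natCast]
      exact Real.rpow_le_rpow_of_exponent_ge hL hL1 (by push_cast; linarith)
    calc ∫⁻ y in ball (0 : EuclideanSpace ℝ (Fin 3)) L, ‖W y‖ₑ ^ 2
        ≤ ENNReal.ofReal (B ^ 2) * volume (ball (0 : EuclideanSpace ℝ (Fin 3)) L) := hbound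
      _ = ENNReal.ofReal (B ^ 2) * (ENNReal.ofReal (L ^ 3) * volume (ball (0 : EuclideanSpace ℝ (Fin 3)) 1)) := by
          rw [hvol]
      _ ≤ ENNReal.ofReal (B ^ 2) * (ENNReal.ofReal (L ^ (1 - 2 * ρ)) *
          volume (ball (0 : EuclideanSpace ℝ (Fin 3)) 1)) := by gcongr
      _ = C * ENNReal.ofReal (L ^ (1 - 2 * ρ)) := by rw [hCdef]; ring
      _ ≤ (K + C) * ENNReal.ofReal (L ^ (1 - 2 * ρ)) := by gcongr; exact le_add_self
  · -- large scales: the slice at `t = −L^{−(2+ρ)}`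
    have hL1' : 1 < L := not_le.1 hL1
    set s : ℝ := L ^ (-(2 + ρ)) with hs
    have hs0 : 0 < s := Real.rpow_pos_of_pos hL _
    have hs1 : s < 1 := Real.rpow_lt_one_of_one_lt_of_neg hL1' (by linarith)
    have ht : (-s) ∈ Ioo (-1 : ℝ) 0 := ⟨by linarith, by linarith⟩
    have ht0 : -s < 0 := by linarith
    have key := lintegral_ball_enorm_sq_selfSimilarCollapse γ ht0 W 1
    rw [neg_neg, ← hv (-s) ht0, mul_one] at key
    -- the exponents: `s^{−γ} = L`, `s^{5γ−2} = L^{2ρ−1}`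
    have hsL : s ^ (-γ) = L := by
      rw [hs, ← Real.rpow_mul hL.le, show -(2 + ρ) * -γ = γ * (2 + ρ) by ring, hγρ, Real.rpow_one]
    have hs5 : s ^ (5 * γ - 2) = L ^ (2 * ρ - 1) := by
      rw [hs, ← Real.rpow_mul hL.le]
      congr 1
      linear_combination (-5 : ℝ) * hγρ
    rw [hsL, hs5] at key
    -- `ofReal(L^{2ρ−1}) * ∫_{B_L}‖W‖² ≤ K`
    have hle : ENNReal.ofReal (L ^ (2 * ρ - 1)) * ∫⁻ y in ball (0 : EuclideanSpace ℝ (Fin 3)) L, ‖W y‖ₑ ^ 2 ≤ K := by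
      rw [← key]; exact hslice (-s) ht
    have hunit : ENNReal.ofReal (L ^ (1 - 2 * ρ)) * ENNReal.ofReal (L ^ (2 * ρ - 1)) = 1 := by
      rw [← ENNReal.ofReal_mul (Real.rpow_nonneg hL.le _), ← Real.rpow_add hL,
        show (1 - 2 * ρ) + (2 * ρ - 1) = 0 by ring, Real.rpow_zero, ENNReal.ofReal_one]
    calc ∫⁻ y in ball (0 : EuclideanSpace ℝ (Fin 3)) L, ‖W y‖ₑ ^ 2
        = ENNReal.ofReal (L ^ (1 - 2 * ρ)) * (ENNReal.ofReal (L ^ (2 * ρ - 1)) *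
            ∫⁻ y in ball (0 : EuclideanSpace ℝ (Fin 3)) L, ‖W y‖ₑ ^ 2) := by
          rw [← mul_assoc, hunit, one_mul]
      _ ≤ ENNReal.ofReal (L ^ (1 - 2 * ρ)) * K := by gcongr
      _ ≤ (K + C) * ENNReal.ofReal (L ^ (1 - 2 * ρ)) := by rw [mul_comm]; gcongr; exact le_self_add

/-! ### The weighted dissipation of the profile -/

/-- **THE OWN-RATE `E`-WEIGHT IS FINITE** (`γ = 1/(2+ρ)`, `−2 < ρ < 1`): if `K(τ) = (−τ)^{−1} • G((−τ)^{−γ} ·)` (`τ < 0`, pointwise) with `G` CONTINUOUS,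
`uncurry K` a.e.-strongly measurable on the slab, and `∫_{Q_1(0,0)} |K|²_F < ∞`, then `∫ |G(z)|²_F ‖z‖^{ρ−1} dz < ∞`: the tail `‖z‖ ≥ 1` by the reverse
Tonelli bound on the unit cylinder, the ball `‖z‖ < 1` by `|G|²_F ≤ B` there and the local integrability of `‖z‖^{ρ−1}` in `ℝ³`
(`integrableOn_ball_of_norm_le_rpow`, `1 − ρ < 3`). [folklore] -/
theorem gradientWeight_ne_top {ρ : ℝ} (hρ : 0 < 2 + ρ) (hρ1 : ρ < 1)
    {K : ℝ → EuclideanSpace ℝ (Fin 3) → EuclideanSpace ℝ (Fin 3) →L[ℝ] EuclideanSpace ℝ (Fin 3)}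
    {G : EuclideanSpace ℝ (Fin 3) → EuclideanSpace ℝ (Fin 3) →L[ℝ] EuclideanSpace ℝ (Fin 3)} (hGc : Continuous G)
    (hKm : AEStronglyMeasurable (uncurry K)
      (volume.restrict (Iio (0 : ℝ) ×ˢ (univ : Set (EuclideanSpace ℝ (Fin 3))))))
    (hK : ∀ τ : ℝ, τ < 0 → K τ = fun x => (-τ) ^ (-1 : ℝ) • G ((-τ) ^ (-(1 / (2 + ρ))) • x))
    (hX : ∫⁻ q in parabolicCylinder 1 (0 : ℝ × EuclideanSpace ℝ (Fin 3)),
      ENNReal.ofReal (frobeniusNormSq (K q.1 q.2)) ≠ ⊤) :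
    ∫⁻ z, ENNReal.ofReal (frobeniusNormSq (G z)) * ENNReal.ofReal (‖z‖ ^ (ρ - 1)) ≠ ⊤ := by
  set γ : ℝ := 1 / (2 + ρ) with hγ
  have hγρ : γ * (2 + ρ) = 1 := by rw [hγ]; field_simp
  have hγ0 : 0 < γ := by rw [hγ]; positivity
  have hq : -1 < 3 * γ - 2 := by
    have : 1 / 3 < γ := by rw [hγ, div_lt_div_iff₀ (by norm_num) hρ]; linarith
    linarith
  have hfm : Measurable fun L : EuclideanSpace ℝ (Fin 3) →L[ℝ] EuclideanSpace ℝ (Fin 3) =>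
      ENNReal.ofReal (frobeniusNormSq L) :=
    (SereginZajaczkowski2007.continuous_frobeniusNormSq).measurable.ennreal_ofReal
  set g : EuclideanSpace ℝ (Fin 3) → ℝ≥0∞ := fun y => ENNReal.ofReal (frobeniusNormSq (G y)) with hg
  have hgm : AEMeasurable g volume := (hfm.comp hGc.measurable).aemeasurable
  set w : EuclideanSpace ℝ (Fin 3) → ℝ≥0∞ := fun z => g z * ENNReal.ofReal (‖z‖ ^ (ρ - 1)) with hw
  -- ### TAIL `‖z‖ ≥ 1`: the unit cylinder in profile variables + the reverse Tonelli bound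
  set X : ℝ≥0∞ := ∫⁻ q in parabolicCylinder 1 (0 : ℝ × EuclideanSpace ℝ (Fin 3)),
    ENNReal.ofReal (frobeniusNormSq (K q.1 q.2)) with hXdef
  have hKmQ : AEMeasurable (fun q : ℝ × EuclideanSpace ℝ (Fin 3) =>
      ENNReal.ofReal (frobeniusNormSq (K q.1 q.2)))
      (((volume : Measure ℝ).restrict (Ioo (-((1 : ℝ) ^ 2)) 0)).prod
        ((volume : Measure (EuclideanSpace ℝ (Fin 3))).restrict (ball 0 1))) := by
    have hsub : Ioo (-((1 : ℝ) ^ 2)) 0 ×ˢ ball (0 : EuclideanSpace ℝ (Fin 3)) 1 ⊆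
        Iio (0 : ℝ) ×ˢ (univ : Set (EuclideanSpace ℝ (Fin 3))) :=
      prod_mono (fun t ht => ht.2) (subset_univ _)
    have := hfm.comp_aemeasurable (hKm.mono_measure (Measure.restrict_mono hsub le_rfl)).aemeasurable
    rwa [Measure.volume_eq_prod, ← Measure.prod_restrict] at this
  have hXeq : X = ∫⁻ τ in Ioo (-((1 : ℝ) ^ 2)) 0, ENNReal.ofReal ((-τ) ^ (3 * γ - 2)) *
      ∫⁻ y in ball (0 : EuclideanSpace ℝ (Fin 3)) ((-τ) ^ (-γ) * 1), g y := by
    rw [hXdef]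
    unfold parabolicCylinder
    rw [Prod.fst_zero, Prod.snd_zero, zero_sub, Measure.volume_eq_prod, ← Measure.prod_restrict,
      lintegral_prod _ hKmQ]
    refine setLIntegral_congr_fun measurableSet_Ioo fun τ hτ => ?_
    have key := lintegral_ball_frobeniusNormSq_selfSimilarGradient γ hτ.2 G 1
    rw [show (fun x => ENNReal.ofReal (frobeniusNormSq ((-τ) ^ (-1 : ℝ) • G ((-τ) ^ (-γ) • x)))) =
      fun x => ENNReal.ofReal (frobeniusNormSq (K τ x)) by rw [hK τ hτ.2]] at key
    exact key
  have hexp : -((3 * γ - 2 + 1) / γ) = ρ - 1 := by rw [hγ]; field_simp; ring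
  have hcore := lintegral_Ioo_rpow_mul_ball_ge hγ0 hq hgm
  rw [hexp, ← hXeq] at hcore
  -- `hcore : ofReal(1/(3γ−1)) * ∫_{‖z‖≥1} w ≤ X`
  have hc0 : ENNReal.ofReal (1 / (3 * γ - 2 + 1)) ≠ 0 := by
    rw [ENNReal.ofReal_ne_zero_iff]; exact div_pos one_pos (by linarith)
  have htail : ∫⁻ z in {z : EuclideanSpace ℝ (Fin 3) | 1 ≤ ‖z‖}, w z ≠ ⊤ := by
    have h1 : ∫⁻ z in {z : EuclideanSpace ℝ (Fin 3) | 1 ≤ ‖z‖}, w z ≤ (ENNReal.ofReal (1 / (3 * γ - 2 + 1)))⁻¹ * X :=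
      calc ∫⁻ z in {z : EuclideanSpace ℝ (Fin 3) | 1 ≤ ‖z‖}, w z
          = (ENNReal.ofReal (1 / (3 * γ - 2 + 1)))⁻¹ * (ENNReal.ofReal (1 / (3 * γ - 2 + 1)) *
              ∫⁻ z in {z : EuclideanSpace ℝ (Fin 3) | 1 ≤ ‖z‖}, w z) := by
            rw [← mul_assoc, ENNReal.inv_mul_cancel hc0 ENNReal.ofReal_ne_top, one_mul]
        _ ≤ (ENNReal.ofReal (1 / (3 * γ - 2 + 1)))⁻¹ * X := by gcongr
    exact ne_top_of_le_ne_top (ENNReal.mul_ne_top (ENNReal.inv_ne_top.2 hc0) hX) h1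
  -- ### NEAR `‖z‖ < 1`: `|G|²_F ≤ B` and `‖z‖^{ρ−1}` is integrable on the unit ball of `ℝ³`
  obtain ⟨B, hB⟩ : ∃ B, ∀ z ∈ closedBall (0 : EuclideanSpace ℝ (Fin 3)) 1, ‖frobeniusNormSq (G z)‖ ≤ B :=
    (isCompact_closedBall 0 1).exists_bound_of_continuousOn
      ((SereginZajaczkowski2007.continuous_frobeniusNormSq.comp hGc).continuousOn)
  set f : EuclideanSpace ℝ (Fin 3) → ℝ := fun z => frobeniusNormSq (G z) * ‖z‖ ^ (ρ - 1) with hf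
  have hint : IntegrableOn f (ball (0 : EuclideanSpace ℝ (Fin 3)) 1) volume := by
    refine integrableOn_ball_of_norm_le_rpow (μ := volume) (by rw [finrank_euclideanSpace_fin]; norm_num)
      (C := B) (α := 1 - ρ) (by rw [finrank_euclideanSpace_fin]; push_cast; linarith) ?_ ?_
    · refine ae_restrict_of_forall_mem measurableSet_ball fun z hz => ?_
      have hfz : 0 ≤ frobeniusNormSq (G z) := frobeniusNormSq_nonneg _
      rw [hf]
      dsimp only
      rw [norm_mul, Real.norm_of_nonneg hfz, Real.norm_of_nonneg (Real.rpow_nonneg (norm_nonneg _) _), neg_sub]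
      exact mul_le_mul_of_nonneg_right ((le_abs_self _).trans (hB z (ball_subset_closedBall hz)))
        (Real.rpow_nonneg (norm_nonneg _) _)
    · exact ((SereginZajaczkowski2007.continuous_frobeniusNormSq.comp hGc).measurable.mul
        (measurable_norm.pow_const _)).aestronglyMeasurable
  have hnear : ∫⁻ z in ball (0 : EuclideanSpace ℝ (Fin 3)) 1, w z ≠ ⊤ := by
    have heq : ∀ z, w z = ‖f z‖ₑ := by
      intro z
      have hfz : 0 ≤ frobeniusNormSq (G z) := frobeniusNormSq_nonneg _
      rw [hw, hg, hf]
      dsimp only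
      rw [Real.enorm_eq_ofReal (mul_nonneg hfz (Real.rpow_nonneg (norm_nonneg _) _)),
        ENNReal.ofReal_mul hfz]
    simp_rw [heq]
    exact hint.2.ne
  have hcompl : (ball (0 : EuclideanSpace ℝ (Fin 3)) 1)ᶜ ⊆ {z : EuclideanSpace ℝ (Fin 3) | 1 ≤ ‖z‖} := by
    intro z hz
    rw [mem_compl_iff, mem_ball_zero_iff, not_lt] at hz
    exact hz
  rw [← lintegral_add_compl w measurableSet_ball]
  exact ENNReal.add_ne_top.2 ⟨hnear, ne_top_of_le_ne_top htail (lintegral_mono_set hcompl)⟩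

/-! ### The weighted pressure integral of the profile -/

/-- **THE OWN-RATE `D`-WEIGHT IS FINITE** (`γ = 1/(2+ρ)`, `−1/2 < ρ < 1`): if `q(τ) = selfSimilarCollapsePressure γ 0 Q τ` (`τ < 0`) with `uncurry q`
a.e.-strongly measurable on the slab, `Q` a.e.-strongly measurable and ESSENTIALLY BOUNDED on the unit ball, and `∫_{Q_1(0,0)} |q|^{3/2} < ∞`, then
`∫ |Q(z)|^{3/2} ‖z‖^{2ρ−2} dz < ∞` (tail by the reverse Tonelli bound; ball by `integrableOn_ball_of_norm_le_rpow`, `2 − 2ρ < 3`). [folklore] -/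
theorem pressureWeight_ne_top {ρ : ℝ} (hρ : -1 / 2 < ρ) (hρ1 : ρ < 1)
    {q : ℝ → EuclideanSpace ℝ (Fin 3) → ℝ} {Q : EuclideanSpace ℝ (Fin 3) → ℝ}
    (hQm : AEStronglyMeasurable Q volume)
    (hQb : ∃ B : ℝ, ∀ᵐ z ∂(volume.restrict (ball (0 : EuclideanSpace ℝ (Fin 3)) 1)), |Q z| ≤ B)
    (hqm : AEStronglyMeasurable (uncurry q)
      (volume.restrict (Iio (0 : ℝ) ×ˢ (univ : Set (EuclideanSpace ℝ (Fin 3))))))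
    (hq : ∀ τ : ℝ, τ < 0 → q τ = selfSimilarCollapsePressure (1 / (2 + ρ)) 0 Q τ)
    (hX : ∫⁻ z in parabolicCylinder 1 (0 : ℝ × EuclideanSpace ℝ (Fin 3)), ‖q z.1 z.2‖ₑ ^ (3 / 2 : ℝ) ≠ ⊤) :
    ∫⁻ z, ‖Q z‖ₑ ^ (3 / 2 : ℝ) * ENNReal.ofReal (‖z‖ ^ (2 * ρ - 2)) ≠ ⊤ := by
  have hρ2 : 0 < 2 + ρ := by linarith
  set γ : ℝ := 1 / (2 + ρ) with hγ
  have hγρ : γ * (2 + ρ) = 1 := by rw [hγ]; field_simp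
  have hγ0 : 0 < γ := by rw [hγ]; positivity
  have he : -1 < 6 * γ - 3 := by
    have : 1 / 3 < γ := by rw [hγ, div_lt_div_iff₀ (by norm_num) hρ2]; linarith
    linarith
  set g : EuclideanSpace ℝ (Fin 3) → ℝ≥0∞ := fun y => ‖Q y‖ₑ ^ (3 / 2 : ℝ) with hg
  have hgm : AEMeasurable g volume := hQm.aemeasurable.enorm.pow_const _
  set w : EuclideanSpace ℝ (Fin 3) → ℝ≥0∞ := fun z => g z * ENNReal.ofReal (‖z‖ ^ (2 * ρ - 2)) with hw
  set X : ℝ≥0∞ := ∫⁻ z in parabolicCylinder 1 (0 : ℝ × EuclideanSpace ℝ (Fin 3)), ‖q z.1 z.2‖ₑ ^ (3 / 2 : ℝ) with hXdef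
  have hqmQ : AEMeasurable (fun z : ℝ × EuclideanSpace ℝ (Fin 3) => ‖q z.1 z.2‖ₑ ^ (3 / 2 : ℝ))
      (((volume : Measure ℝ).restrict (Ioo (-((1 : ℝ) ^ 2)) 0)).prod
        ((volume : Measure (EuclideanSpace ℝ (Fin 3))).restrict (ball 0 1))) := by
    have hsub : Ioo (-((1 : ℝ) ^ 2)) 0 ×ˢ ball (0 : EuclideanSpace ℝ (Fin 3)) 1 ⊆
        Iio (0 : ℝ) ×ˢ (univ : Set (EuclideanSpace ℝ (Fin 3))) :=
      prod_mono (fun t ht => ht.2) (subset_univ _)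
    have := (hqm.mono_measure (Measure.restrict_mono hsub le_rfl)).enorm.pow_const (3 / 2 : ℝ)
    rwa [Measure.volume_eq_prod, ← Measure.prod_restrict] at this
  have hXeq : X = ∫⁻ τ in Ioo (-((1 : ℝ) ^ 2)) 0, ENNReal.ofReal ((-τ) ^ (6 * γ - 3)) *
      ∫⁻ y in ball (0 : EuclideanSpace ℝ (Fin 3)) ((-τ) ^ (-γ) * 1), g y := by
    rw [hXdef]
    unfold parabolicCylinder
    rw [Prod.fst_zero, Prod.snd_zero, zero_sub, Measure.volume_eq_prod, ← Measure.prod_restrict,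
      lintegral_prod _ hqmQ]
    refine setLIntegral_congr_fun measurableSet_Ioo fun τ hτ => ?_
    have key := lintegral_ball_enorm_rpow_selfSimilarCollapsePressure γ hτ.2 Q 1
    rw [← hq τ hτ.2] at key
    exact key
  have hexp : -((6 * γ - 3 + 1) / γ) = 2 * ρ - 2 := by rw [hγ]; field_simp; ring
  have hcore := lintegral_Ioo_rpow_mul_ball_ge hγ0 he hgm
  rw [hexp, ← hXeq] at hcore
  have hc0 : ENNReal.ofReal (1 / (6 * γ - 3 + 1)) ≠ 0 := by
    rw [ENNReal.ofReal_ne_zero_iff]; exact div_pos one_pos (by linarith)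
  have htail : ∫⁻ z in {z : EuclideanSpace ℝ (Fin 3) | 1 ≤ ‖z‖}, w z ≠ ⊤ := by
    have h1 : ∫⁻ z in {z : EuclideanSpace ℝ (Fin 3) | 1 ≤ ‖z‖}, w z ≤ (ENNReal.ofReal (1 / (6 * γ - 3 + 1)))⁻¹ * X :=
      calc ∫⁻ z in {z : EuclideanSpace ℝ (Fin 3) | 1 ≤ ‖z‖}, w z
          = (ENNReal.ofReal (1 / (6 * γ - 3 + 1)))⁻¹ * (ENNReal.ofReal (1 / (6 * γ - 3 + 1)) *
              ∫⁻ z in {z : EuclideanSpace ℝ (Fin 3) | 1 ≤ ‖z‖}, w z) := by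
            rw [← mul_assoc, ENNReal.inv_mul_cancel hc0 ENNReal.ofReal_ne_top, one_mul]
        _ ≤ (ENNReal.ofReal (1 / (6 * γ - 3 + 1)))⁻¹ * X := by gcongr
    exact ne_top_of_le_ne_top (ENNReal.mul_ne_top (ENNReal.inv_ne_top.2 hc0) hX) h1
  obtain ⟨B, hB⟩ := hQb
  set f : EuclideanSpace ℝ (Fin 3) → ℝ := fun z => ‖Q z‖ ^ (3 / 2 : ℝ) * ‖z‖ ^ (2 * ρ - 2) with hf
  have hint : IntegrableOn f (ball (0 : EuclideanSpace ℝ (Fin 3)) 1) volume := by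
    refine integrableOn_ball_of_norm_le_rpow (μ := volume) (by rw [finrank_euclideanSpace_fin]; norm_num)
      (C := |B| ^ (3 / 2 : ℝ)) (α := 2 - 2 * ρ) (by rw [finrank_euclideanSpace_fin]; push_cast; linarith) ?_ ?_
    · filter_upwards [hB] with z hz
      have h1 : 0 ≤ ‖Q z‖ ^ (3 / 2 : ℝ) := Real.rpow_nonneg (norm_nonneg _) _
      rw [hf]
      dsimp only
      rw [norm_mul, Real.norm_of_nonneg h1, Real.norm_of_nonneg (Real.rpow_nonneg (norm_nonneg _) _), neg_sub]
      refine mul_le_mul_of_nonneg_right ?_ (Real.rpow_nonneg (norm_nonneg _) _)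
      exact Real.rpow_le_rpow (norm_nonneg _) ((Real.norm_eq_abs _).le.trans (hz.trans (le_abs_self B))) (by norm_num)
    · exact ((hQm.norm.aemeasurable.pow_const _).mul
        (measurable_norm.pow_const _).aemeasurable).aestronglyMeasurable
  have hnear : ∫⁻ z in ball (0 : EuclideanSpace ℝ (Fin 3)) 1, w z ≠ ⊤ := by
    have heq : ∀ z, w z = ‖f z‖ₑ := by
      intro z
      have h1 : 0 ≤ ‖Q z‖ ^ (3 / 2 : ℝ) := Real.rpow_nonneg (norm_nonneg _) _
      rw [hw, hg, hf]
      dsimp only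
      rw [Real.enorm_eq_ofReal (mul_nonneg h1 (Real.rpow_nonneg (norm_nonneg _) _)),
        ENNReal.ofReal_mul h1, ← ofReal_norm, ENNReal.ofReal_rpow_of_nonneg (norm_nonneg _) (by norm_num)]
    simp_rw [heq]
    exact hint.2.ne
  have hcompl : (ball (0 : EuclideanSpace ℝ (Fin 3)) 1)ᶜ ⊆ {z : EuclideanSpace ℝ (Fin 3) | 1 ≤ ‖z‖} := by
    intro z hz
    rw [mem_compl_iff, mem_ball_zero_iff, not_lt] at hz
    exact hz
  rw [← lintegral_add_compl w measurableSet_ball]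
  exact ENNReal.add_ne_top.2 ⟨hnear, ne_top_of_le_ne_top htail (lintegral_mono_set hcompl)⟩

end ClockTransfer

end Summit.NavierStokesRegularity.NavierStokesRegularity.Theorems.PowerGaugeEulerLiouville
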